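import Literature.Analysis.SpecialFunctions.RiemannThetaCharMultiplication
import Literature.Analysis.SpecialFunctions.RiemannThetaCharIndependent
import Literature.Analysis.Complex.ThetaProductRigidity
import Mathlib.LinearAlgebra.Dimension.Finrank
import Mathlib.LinearAlgebra.FiniteDimensional.Defs
import HarnessLib

/-!
# Koizumi's rank theorem: the matrix `(ϑ[l₁ + b/β + a/α; l₂](Ω, x))_{b, a}` has full column rank

Layer `Literature/Analysis/SpecialFunctions`, namespace `Literature.Analysis.SpecialFunctions`; lane
`lit-hodgefound` (Layer A2, seat `lit-hodgefound-skel-2`, generation 19), row **A2-75**, FILE 2 (sequel of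
`RiemannThetaCharMultiplication`, the generalized addition formula). THEOREMS ONLY (no definition, no
named fact, no `sorry`).

Source followed: S. Koizumi, *On the structure of the graded ℂ-algebras of theta functions*, Proc. Japan
Acad. **51** (1975) 325–328 (key `Koizumi1975GradedAlgebrasTheta`, held `paper:galaxy-pdf-7080252123399715800`),
§3, VERBATIM [p0002–p0003]:

> "**3. The rank theorem.** Connecting with the problem (c), we consider the question: (c′) when is the
> multiplication map `Θ_α((z, e), m) ⊗ Θ_β((z, e), m) → Θ_{α+β}((z, e), m)` surjective? From the
> formula (2.b) we can image that some result concerning the rank of a certain matrix with theta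
> constants as its coefficients is needed. That is the reason why we give the following theorem, which
> is essential in the sequel. **Theorem 3** (The rank theorem). For `α, β ∈ ℤ₊` such that g.c.d.
> `(α, β) = 1` and `β > α`, `l ∈ ℝ^{2n}`, `z⁽⁰⁾ ∈ ℌ_n` and `x⁽⁰⁾ ∈ ℂ^n`, we have
> `rank (θ[l + (b₁ + a₁; 0)](z⁽⁰⁾ | x⁽⁰⁾))_{(b₁, a₁) ∈ U_β × U_α} = αⁿ`.
> For proof of the theorem we use the formula (3.a) for `a₂ ∈ U_α`, which follows from (2.a) by
> certain substitutions (esp. `γ = α` etc.): (3.a) `θ[k⁽¹⁾](αz | αx⁽¹⁾) · θ[k⁽²⁾ + (0; (α+β)a₂)](βz | βx⁽²⁾)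
> = e((α+β) ᵗk₁⁽²⁾a₂) Σ_{p₁ ∈ U_{α+β}} { Σ_{a₁ ∈ U_α} e(α(α+β) ᵗa₁a₂)
> θ[α⁻¹(α+β)⁻¹(αk₁⁽¹⁾ + βk₁⁽²⁾) + p₁ + a₁; α(k₂⁽¹⁾ + k₂⁽²⁾)](α²(α+β)z | α(αx⁽¹⁾ + βx⁽²⁾)) }
> × θ[((α+β)⁻¹(−k₁⁽¹⁾ + k₁⁽²⁾) − p₁; −βk₂⁽¹⁾ + αk₂⁽²⁾)](αβ(α+β)z | αβ(−x⁽¹⁾ + x⁽²⁾))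
> and the fact that `{θ[k + (0; a₂)](z | x) | a₂ ∈ U_α}` are linearly independent over ℂ (as
> functions of `x ∈ ℂ^n`)."

The full proof is in S. Koizumi, Amer. J. Math. **98** (1976) 865–889, §3 (key `Koizumi1976ThetaRelations`,
not held — acq-10299); the proof below is the one SKETCHED in the note, written out (Koizumi's pair
`(α, β)` of (3.a) is our `(α, β″)`, with `β = α + β″` the `β` of Theorem 3).

## Dictionary

* `θ[k](z | x)` = `riemannThetaChar k₁ k₂ z x`; `U_α ∋ a₁ = a/α`, `a ∈ {0,…,α−1}^g` = `Fin g → Fin α`;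
  the matrix of Theorem 3 is `M[b, a] = ϑ[l₁ + b/β + a/α; l₂](Ω₀, x₀)`, `b ∈ {0,…,β−1}^g`,
  `a ∈ {0,…,α−1}^g` (`l = (l₁; l₂)` complex here); "rank `= αⁿ`" (`αⁿ` = the number of columns) is
  stated as: **the `α^g` columns are linearly independent** (`linearIndependent_riemannThetaChar_rank`),
  and as `dim span(columns) = α^g` (`finrank_span_riemannThetaChar_rank`).

## The proof (§3 of this file)

With `β = α + β″`, `Ω = Ω₀/(α²β)`, `x₁ = x₀/(αβ)`: by (2.a) at levels `α, β″` with `γ = α`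
(`riemannThetaChar_mul_riemannThetaChar_level`) applied to `k⁽¹⁾ = (βl₁; l₂/α)`, `k⁽²⁾ = (0; (β/α)A)`,
`x⁽¹⁾ = x₁ − β″s`, `x⁽²⁾ = x₁ + αs`, and the integral shifts of the second characteristic
(`riemannThetaChar_charShift_snd`, shift `βA ∈ ℤ^g`; the two roots of unity combine to
`e(2πi (β/α) ᵗkA)` — this is (3.a)), the `α^g` functions
`F_A(s) = ϑ[βl₁; l₂/α](αΩ, α(x₁ − β″s)) · ϑ[0; (β/α)A](β″Ω, β″(x₁ + αs))`, `A ∈ {0,…,α−1}^g`, expand as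
`F_A(s) = Σ_p (Σ_k e(2πi (β/α) ᵗkA) · M[p, k]) · G_p(s)` with `G_p` independent of `A` (`hF`). The `F_A`
are linearly independent (`hFind`): the second factors are `ϑ[0; (β/α)A]` precomposed with an affine
bijection, their second characteristics `(β/α)A` are pairwise distinct mod `ℤ^g` BECAUSE `gcd(α, β) = 1`
(`charShift_injective_of_coprime`) so §1 applies, and the first factor is a fixed entire function `≢ 0`
(§2; entire functions form an integral domain — the tree's `ThetaRigidity.eq_zero_of_mul_eq_zero`). Hence
the `α^g` coefficient vectors `p ↦ Σ_k e(2πi(β/α)ᵗkA) M[p, k]` are linearly independent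
(`linearIndependent_of_expansion`); they lie in the span of the `α^g` columns of `M`, which are therefore
linearly independent (`linearIndependent_of_linearIndependent_mem_span`, a dimension count).

## Contents (all theorems)

* §1 **`linearIndependent_riemannThetaChar_snd`** — `ϑ[a; b_j](·, Ω)` with SECOND characteristics
  `b_j` pairwise distinct mod `ℤ^g` are linearly independent (Dedekind's independence of the characters
  `n ↦ e(−2πi ᵗb_j n)` under `z ↦ z + Ωn`; companion of the tree's `linearIndependent_riemannThetaChar`
  for first characteristics).
* §2 (private) stability of linear independence under surjective precomposition and under
  multiplication by an entire function `≢ 0`.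
* §3 **`linearIndependent_riemannThetaChar_rank`** (Theorem 3) and **`finrank_span_riemannThetaChar_rank`**
  (`dim = α^g`), with the private steps named above.

NOT here: Lemmas 4.1/4.2, Thm. 4.3 (surjection), Thm. 5.1, Cor. 5.2/5.3 (next file of the row).

## References

* [Koizumi1975GradedAlgebrasTheta] S. Koizumi, Proc. Japan Acad. 51 (1975) 325–328, §3 Thm. 3, (3.a)
  (chunks p0002–p0003).
* [Koizumi1976ThetaRelations] S. Koizumi, Amer. J. Math. 98 (1976) 865–889, §3.
* [MumfordTata1] D. Mumford, Tata Lectures on Theta I (1983), Ch. II §1 (quasi-periodicity).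
* [LangeBirkenhake1992] H. Lange, Ch. Birkenhake, Complex Abelian Varieties, §3.3.2 Prop. 3.3.6.
-/

noncomputable section

open Complex Real Finset Filter Topology Matrix
open Literature.Analysis.Complex Literature.Analysis.Complex.ThetaRigidity

namespace Literature.Analysis.SpecialFunctions

variable {g : ℕ}

/-! ### §1 Theta functions with distinct SECOND characteristics are linearly independent -/

/-- **`ϑ[a; b_j](·, Ω)` with `b_j` pairwise distinct modulo `ℤ^g` are linearly independent**
(fixed `a`; symmetric `Ω`, `Im Ω ≥ c > 0`): `z ↦ z + Ωn` multiplies `ϑ[a; b_j]` by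
`exp(−πi ᵗnΩn − 2πi ᵗn z)·exp(−2πi ᵗb_j n)`, the characters `n ↦ exp(−2πi ᵗb_j n)` of `ℤ^g` are
pairwise distinct, and Dedekind's independence of characters with `ϑ[a; b_j] ≢ 0` concludes — "the
fact that `{θ[k + (0; a₂)](z | x) | a₂ ∈ U_α}` are linearly independent over ℂ (as functions of
`x ∈ ℂ^n`)" used in the proof of the rank theorem. [cite: Koizumi1975GradedAlgebrasTheta, §3 (proof of Thm. 3)]
[cite: MumfordTata1, Ch. II §1] -/
theorem linearIndependent_riemannThetaChar_snd {ι : Type*} (Ω : Matrix (Fin g) (Fin g) ℂ)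
    (hΩ : ∀ i j, Ω i j = Ω j i) {c : ℝ} (hc : 0 < c)
    (hY : ∀ x : Fin g → ℝ, c * ∑ i, x i ^ 2 ≤ ∑ i, ∑ j, x i * (Ω i j).im * x j)
    (a : Fin g → ℂ) (b : ι → Fin g → ℂ)
    (hb : ∀ j j', (∃ k : Fin g → ℤ, b j - b j' = fun i => (k i : ℂ)) → j = j') :
    LinearIndependent ℂ fun j => riemannThetaChar a (b j) Ω := by
  classical
  -- the characters `n ↦ exp(-2πi ᵗb_j n)` of `ℤ^g`
  let χ : ι → (Multiplicative (Fin g → ℤ) →* ℂ) := fun j =>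
    { toFun := fun n => cexp (-(2 * π * I * (b j ⬝ᵥ fun i => ((Multiplicative.toAdd n) i : ℂ))))
      map_one' := by simp
      map_mul' := fun n n' => by
        rw [← Complex.exp_add]
        congr 1
        simp only [toAdd_mul, Pi.add_apply, Int.cast_add]
        rw [show (fun i => ((Multiplicative.toAdd n i : ℤ) : ℂ) + ((Multiplicative.toAdd n' i : ℤ) : ℂ)) =
          (fun i => ((Multiplicative.toAdd n i : ℤ) : ℂ)) + fun i => ((Multiplicative.toAdd n' i : ℤ) : ℂ)
          from rfl, dotProduct_add]
        ring }
  have hχapply : ∀ j (n : Fin g → ℤ),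
      χ j (Multiplicative.ofAdd n) = cexp (-(2 * π * I * (b j ⬝ᵥ fun i => (n i : ℂ)))) :=
    fun j n => rfl
  -- they are pairwise distinct
  have hχ : Function.Injective χ := by
    intro j j' hjj'
    apply hb
    have key : ∀ i, ∃ k : ℤ, b j i - b j' i = k := by
      intro i
      have h := DFunLike.congr_fun hjj' (Multiplicative.ofAdd (-(Pi.single i 1)))
      rw [hχapply, hχapply] at h
      have e1 : ∀ v : Fin g → ℂ, (v ⬝ᵥ fun i' => (((-(Pi.single (M := fun _ : Fin g => ℤ) i 1)) i' : ℤ) : ℂ)) = -v i := by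
        intro v
        rw [show (fun i' => (((-(Pi.single (M := fun _ : Fin g => ℤ) i 1)) i' : ℤ) : ℂ)) =
          -(Pi.single i (1 : ℂ)) from by
            funext i'
            by_cases h : i' = i
            · subst h; simp
            · simp [h]]
        rw [dotProduct_neg, dotProduct_single, mul_one]
      rw [e1, e1, show -(2 * π * I * -b j i) = 2 * π * I * b j i by ring,
        show -(2 * π * I * -b j' i) = 2 * π * I * b j' i by ring] at h
      obtain ⟨n, hn⟩ := Complex.exp_eq_exp_iff_exists_int.mp h
      refine ⟨n, ?_⟩
      have h2 : (2 * π * I : ℂ) ≠ 0 := by simp [Real.pi_ne_zero, Complex.I_ne_zero]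
      have h3 : 2 * π * I * (b j i - b j' i - n) = 0 := by rw [mul_sub, mul_sub, hn]; ring
      rcases mul_eq_zero.mp h3 with h4 | h4
      · exact absurd h4 h2
      · exact sub_eq_zero.mp h4
    choose k hk using key
    exact ⟨k, funext fun i => by simpa using hk i⟩
  -- Dedekind for the family `χ`
  have hDed := (linearIndependent_monoidHom (Multiplicative (Fin g → ℤ)) ℂ).comp χ hχ
  rw [linearIndependent_iff']
  intro s coef hsum j hj
  have hz : ∀ z, coef j * riemannThetaChar a (b j) Ω z = 0 := by
    intro z
    refine (linearIndependent_iff'.mp hDed) s (fun j' => coef j' * riemannThetaChar a (b j') Ω z)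
      ?_ j hj
    funext n
    set nv : Fin g → ℤ := Multiplicative.toAdd n with hnv
    have h := congr_fun hsum (z + Ω *ᵥ fun i => (nv i : ℂ))
    simp only [Finset.sum_apply, Pi.smul_apply, smul_eq_mul, Pi.zero_apply] at h ⊢
    -- the common (non-zero) factor `exp(-πi ᵗnΩn - 2πi ᵗn z)`
    set C : ℂ := cexp (-(π * I * ((fun i => (nv i : ℂ)) ⬝ᵥ (Ω *ᵥ fun i => (nv i : ℂ)))) -
        2 * π * I * ((fun i => (nv i : ℂ)) ⬝ᵥ z)) with hC
    have hC0 : C ≠ 0 := Complex.exp_ne_zero _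
    have hterm : ∀ j', coef j' * riemannThetaChar a (b j') Ω (z + Ω *ᵥ fun i => (nv i : ℂ)) =
        C * (coef j' * riemannThetaChar a (b j') Ω z * (χ j') n) := by
      intro j'
      rw [riemannThetaChar_add_mulVec a (b j') Ω hΩ z nv,
        show χ j' n = cexp (-(2 * π * I * (b j' ⬝ᵥ fun i => (nv i : ℂ)))) from rfl, hC,
        show -(π * I * ((fun i => (nv i : ℂ)) ⬝ᵥ (Ω *ᵥ fun i => (nv i : ℂ)))) -
            2 * π * I * ((fun i => (nv i : ℂ)) ⬝ᵥ z) - 2 * π * I * (b j' ⬝ᵥ fun i => (nv i : ℂ)) =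
          (-(π * I * ((fun i => (nv i : ℂ)) ⬝ᵥ (Ω *ᵥ fun i => (nv i : ℂ)))) -
            2 * π * I * ((fun i => (nv i : ℂ)) ⬝ᵥ z)) +
          (-(2 * π * I * (b j' ⬝ᵥ fun i => (nv i : ℂ)))) by ring, Complex.exp_add]
      ring
    rw [Finset.sum_congr rfl fun j' _ => hterm j', ← Finset.mul_sum] at h
    have h' := (mul_eq_zero.mp h).resolve_left hC0
    rw [← h']
    exact Finset.sum_congr rfl fun j' _ => by simp only [Function.comp_apply]
  obtain ⟨z, hz'⟩ := exists_riemannThetaChar_ne_zero Ω hΩ hc hY a (b j)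
  exact (mul_eq_zero.mp (hz z)).resolve_right hz'

/-! ### §2 Two stability properties of linear independence of function families -/

/-- Precomposing a linearly independent family of functions with a surjection keeps it
linearly independent. [folklore] -/
private theorem linearIndependent_comp_of_surjective {ι : Type*} {X Y : Type*}
    {θ : ι → Y → ℂ} (hθ : LinearIndependent ℂ θ) {φ : X → Y} (hφ : Function.Surjective φ) :
    LinearIndependent ℂ fun j => θ j ∘ φ := by
  rw [linearIndependent_iff'] at hθ ⊢
  intro s coef hsum j hj
  refine hθ s coef ?_ j hj
  funext w
  obtain ⟨x, rfl⟩ := hφ w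
  have h := congr_fun hsum x
  simpa only [Finset.sum_apply, Pi.smul_apply, Function.comp_apply, Pi.zero_apply] using h

/-- Multiplying a linearly independent family of entire functions by an entire function which is
not identically zero keeps it linearly independent (entire functions form an integral domain).
[folklore] -/
private theorem linearIndependent_mul_of_differentiable {ι : Type*}
    {θ : ι → (Fin g → ℂ) → ℂ} (hθ : LinearIndependent ℂ θ) (hθd : ∀ j, Differentiable ℂ (θ j))
    {f : (Fin g → ℂ) → ℂ} (hf : Differentiable ℂ f) (hf0 : f ≠ 0) :
    LinearIndependent ℂ fun j => fun z => f z * θ j z := by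
  rw [linearIndependent_iff'] at hθ ⊢
  intro s coef hsum j hj
  obtain ⟨z₀, hz₀⟩ := Function.ne_iff.mp hf0
  have hS : Differentiable ℂ fun z => ∑ i ∈ s, coef i * θ i z :=
    Differentiable.fun_sum fun i _ => (hθd i).const_mul _
  have hprod : ∀ z, (∑ i ∈ s, coef i * θ i z) * f z = 0 := by
    intro z
    have h := congr_fun hsum z
    simp only [Finset.sum_apply, Pi.smul_apply, smul_eq_mul, Pi.zero_apply] at h
    rw [Finset.sum_mul, ← h]
    exact Finset.sum_congr rfl fun i _ => by ring
  have hzero := ThetaRigidity.eq_zero_of_mul_eq_zero hS hf hprod hz₀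
  refine hθ s coef ?_ j hj
  funext z
  have h := congr_fun hzero z
  simpa only [Finset.sum_apply, Pi.smul_apply, smul_eq_mul, Pi.zero_apply] using h

/-! ### §3 Koizumi's rank theorem -/

/-- `(n : ℂ)⁻¹` for a positive natural `n` is a positive real scalar. [folklore] -/
private theorem natCast_inv_re_im {n : ℕ} (hn : 0 < n) :
    ((n : ℂ)⁻¹).im = 0 ∧ 0 < ((n : ℂ)⁻¹).re := by
  have h : ((n : ℂ))⁻¹ = (((n : ℝ)⁻¹ : ℝ) : ℂ) := by
    rw [Complex.ofReal_inv, Complex.ofReal_natCast]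
  rw [h, Complex.ofReal_im, Complex.ofReal_re]
  exact ⟨rfl, by positivity⟩

/-- From the multiplication formula: linear independence of `p ↦`-coefficient vectors follows from
linear independence of the expanded functions. [folklore] -/
private theorem linearIndependent_of_expansion {ι κ X : Type*} [Fintype κ]
    {F : ι → X → ℂ} {v : ι → κ → ℂ} {G : κ → X → ℂ}
    (hF : ∀ j x, F j x = ∑ p, v j p * G p x) (hFind : LinearIndependent ℂ F) :
    LinearIndependent ℂ v := by
  rw [linearIndependent_iff'] at hFind ⊢
  intro s coef hsum j hj
  refine hFind s coef ?_ j hj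
  funext x
  have hp : ∀ p, ∑ i ∈ s, coef i * v i p = 0 := fun p => by
    have h := congr_fun hsum p
    simpa only [Finset.sum_apply, Pi.smul_apply, smul_eq_mul, Pi.zero_apply] using h
  simp only [Finset.sum_apply, Pi.smul_apply, smul_eq_mul, Pi.zero_apply]
  calc ∑ i ∈ s, coef i * F i x = ∑ i ∈ s, ∑ p, coef i * v i p * G p x := by
        refine Finset.sum_congr rfl fun i _ => ?_
        rw [hF i x, Finset.mul_sum]
        exact Finset.sum_congr rfl fun p _ => by ring
    _ = ∑ p, (∑ i ∈ s, coef i * v i p) * G p x := by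
        rw [Finset.sum_comm]
        exact Finset.sum_congr rfl fun p _ => by rw [Finset.sum_mul]
    _ = 0 := by simp [hp]

/-- A family of `card ι` linearly independent vectors inside the span of a family indexed by the
same finite type `ι` forces the latter to be linearly independent. [folklore] -/
private theorem linearIndependent_of_linearIndependent_mem_span {ι : Type*} [Fintype ι]
    {V : Type*} [AddCommGroup V] [Module ℂ V]
    {v w : ι → V} (hv : LinearIndependent ℂ v)
    (hmem : ∀ j, v j ∈ Submodule.span ℂ (Set.range w)) : LinearIndependent ℂ w := by
  set W := Submodule.span ℂ (Set.range w) with hW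
  haveI : Module.Finite ℂ W := Module.Finite.span_of_finite ℂ (Set.finite_range w)
  let u : ι → W := fun j => ⟨v j, hmem j⟩
  have hu : LinearIndependent ℂ u := LinearIndependent.of_comp W.subtype (by exact hv)
  have h1 : Fintype.card ι ≤ Module.finrank ℂ W := hu.fintype_card_le_finrank
  have h2 : Module.finrank ℂ W ≤ Fintype.card ι := finrank_range_le_card w
  exact linearIndependent_iff_card_eq_finrank_span.mpr (le_antisymm h1 h2)

/-- Distinctness of the second characteristics `((α+β″)/α)·A`, `A ∈ {0,…,α−1}^g`, modulo `ℤ^g`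
when `gcd(α, α+β″) = 1`. [folklore] -/
private theorem charShift_injective_of_coprime {α N : ℕ} (hα : 0 < α) (hcop : Nat.Coprime α N)
    (A A' : Fin g → Fin α)
    (h : ∃ m : Fin g → ℤ, ((N : ℂ) * ((α : ℂ))⁻¹) • (fun i => ((A i : ℕ) : ℂ)) -
      ((N : ℂ) * ((α : ℂ))⁻¹) • (fun i => ((A' i : ℕ) : ℂ)) = fun i => (m i : ℂ)) : A = A' := by
  obtain ⟨m, hm⟩ := h
  funext i
  have hα0 : (α : ℂ) ≠ 0 := by exact_mod_cast hα.ne'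
  have hi := congr_fun hm i
  simp only [Pi.sub_apply, Pi.smul_apply, smul_eq_mul] at hi
  have h2 : (N : ℂ) * ((A i : ℕ) : ℂ) - (N : ℂ) * ((A' i : ℕ) : ℂ) = (α : ℂ) * (m i : ℂ) := by
    rw [← hi]
    field_simp
  have h3 : (N : ℤ) * (((A i : ℕ) : ℤ) - ((A' i : ℕ) : ℤ)) = (α : ℤ) * m i := by
    have : ((N : ℤ) * (((A i : ℕ) : ℤ) - ((A' i : ℕ) : ℤ)) : ℂ) = ((α : ℤ) * m i : ℂ) := by
      push_cast
      rw [mul_sub]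
      exact_mod_cast h2
    exact_mod_cast this
  have hdvd : (α : ℤ) ∣ ((A i : ℕ) : ℤ) - ((A' i : ℕ) : ℤ) := by
    have hd : (α : ℤ) ∣ (N : ℤ) * (((A i : ℕ) : ℤ) - ((A' i : ℕ) : ℤ)) := ⟨m i, h3⟩
    exact (Int.isCoprime_iff_gcd_eq_one.mpr (by
      rw [Int.gcd_natCast_natCast]; exact hcop)).dvd_of_dvd_mul_left hd
  have hlt : (((A i : ℕ) : ℤ) - ((A' i : ℕ) : ℤ)).natAbs < ((α : ℤ)).natAbs := by
    have h1 := (A i).isLt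
    have h2 := (A' i).isLt
    omega
  have h0 := Int.eq_zero_of_dvd_of_natAbs_lt_natAbs hdvd hlt
  exact Fin.ext (by omega)

/-- **Koizumi's rank theorem (Theorem 3)**: "For `α, β ∈ ℤ₊` such that g.c.d. `(α, β) = 1` and
`β > α`, `l ∈ ℝ^{2n}`, `z⁽⁰⁾ ∈ ℌ_n` and `x⁽⁰⁾ ∈ ℂ^n`, we have
`rank (θ[l + (b₁ + a₁; 0)](z⁽⁰⁾ | x⁽⁰⁾))_{(b₁, a₁) ∈ U_β × U_α} = αⁿ`" — here: the `α^g` columns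
`a ↦ (ϑ[l₁ + b/β + a/α; l₂](Ω₀, x₀))_{b ∈ {0,…,β−1}^g}`, `a ∈ {0,…,α−1}^g`, of this `β^g × α^g` matrix
are linearly independent (for `l = (l₁; l₂)` complex). Proof as sketched in the note: the formula (3.a)
(= (2.a) with `γ = α`, levels `α` and `β − α`) expands the `α^g` functions
`s ↦ ϑ[βl₁; l₂/α](αΩ, α(x₁ − (β−α)s)) · ϑ[0; (β/α)A]((β−α)Ω, (β−α)(x₁ + αs))` (`Ω = Ω₀/(α²β)`,
`x₁ = x₀/(αβ)`) as `Σ_p (Σ_k e(2πi(β/α)ᵗkA) ϑ[l₁ + p/β + k/α; l₂](Ω₀, x₀)) · G_p(s)`; these functions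
are linearly independent (distinct second characteristics `(β/α)A mod ℤ^g` as `gcd(α, β) = 1`, times
a fixed entire function `≢ 0`), hence so are the `α^g` coefficient vectors, which lie in the span of
the `α^g` columns. [cite: Koizumi1975GradedAlgebrasTheta, §3 Thm. 3 (3.a)]
[cite: Koizumi1976ThetaRelations, §3] -/
theorem linearIndependent_riemannThetaChar_rank (Ω₀ : Matrix (Fin g) (Fin g) ℂ)
    (hΩ₀ : ∀ i j, Ω₀ i j = Ω₀ j i) {c : ℝ} (hc : 0 < c)
    (hY : ∀ x : Fin g → ℝ, c * ∑ i, x i ^ 2 ≤ ∑ i, ∑ j, x i * (Ω₀ i j).im * x j)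
    {α β : ℕ} (hα : 0 < α) (hαβ : α < β) (hcop : Nat.Coprime α β) (l₁ l₂ x₀ : Fin g → ℂ) :
    LinearIndependent ℂ fun (a : Fin g → Fin α) (b : Fin g → Fin β) =>
      riemannThetaChar (l₁ + ((β : ℂ))⁻¹ • (fun i => ((b i : ℕ) : ℂ)) +
        ((α : ℂ))⁻¹ • (fun i => ((a i : ℕ) : ℂ))) l₂ Ω₀ x₀ := by
  obtain ⟨β'', rfl⟩ := Nat.exists_eq_add_of_le hαβ.le
  have hβ'' : 0 < β'' := by omega
  have hn : 0 < α + β'' := by omega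
  -- scalars
  have hN0 : ((α + β'' : ℕ) : ℂ) ≠ 0 := by exact_mod_cast hn.ne'
  have hα0 : (α : ℂ) ≠ 0 := by exact_mod_cast hα.ne'
  have hβ0 : (β'' : ℂ) ≠ 0 := by exact_mod_cast hβ''.ne'
  have hNcast : ((α + β'' : ℕ) : ℂ) = (α : ℂ) + (β'' : ℂ) := by push_cast; ring
  have hαi : ((α : ℂ)).im = 0 := Complex.natCast_im _
  have hαr : 0 < ((α : ℂ)).re := by rw [Complex.natCast_re]; exact_mod_cast hα
  have hβi : ((β'' : ℂ)).im = 0 := Complex.natCast_im _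
  have hβr : 0 < ((β'' : ℂ)).re := by rw [Complex.natCast_re]; exact_mod_cast hβ''
  -- the rescaled period matrix `Ω = Ω₀/(α²(α+β″))` and base point `x₁ = x₀/(α(α+β″))`
  obtain ⟨hκi, hκr⟩ := natCast_inv_re_im (n := α ^ 2 * (α + β'')) (by positivity)
  set κ : ℂ := ((α ^ 2 * (α + β'') : ℕ) : ℂ)⁻¹ with hκdef
  have hκ : κ = ((α : ℂ) ^ 2 * ((α + β'' : ℕ) : ℂ))⁻¹ := by rw [hκdef]; push_cast; ring
  set Ω : Matrix (Fin g) (Fin g) ℂ := κ • Ω₀ with hΩdef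
  have hΩ : ∀ i j, Ω i j = Ω j i := fun i j => by simp only [hΩdef, Matrix.smul_apply, hΩ₀ i j]
  have hsymm : ∀ k : ℂ, ∀ i j, (k • Ω) i j = (k • Ω) j i := fun k i j => by
    simp only [Matrix.smul_apply, hΩ i j]
  have hcκ : 0 < κ.re * c := mul_pos hκr hc
  have hYκ : ∀ x : Fin g → ℝ, κ.re * c * ∑ i, x i ^ 2 ≤ ∑ i, ∑ j, x i * (Ω i j).im * x j :=
    smul_im_bound Ω₀ hY hκi hκr.le
  set x₁ : Fin g → ℂ := ((α : ℂ) * ((α + β'' : ℕ) : ℂ))⁻¹ • x₀ with hx₁def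
  -- (i) the first modulus is `Ω₀`, (ii) the first argument is `x₀`
  have hmod : ((α : ℂ) ^ 2) • (((α + β'' : ℕ) : ℂ) • Ω) = Ω₀ := by
    rw [hΩdef, smul_smul, smul_smul, hκ, mul_inv_cancel₀ (mul_ne_zero (pow_ne_zero 2 hα0) hN0),
      one_smul]
  have harg : ∀ s : Fin g → ℂ, (α : ℂ) • ((α : ℂ) • (x₁ - (β'' : ℂ) • s) +
      (β'' : ℂ) • (x₁ + (α : ℂ) • s)) = x₀ := by
    intro s
    funext i
    simp only [hx₁def, Pi.smul_apply, Pi.add_apply, Pi.sub_apply, smul_eq_mul]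
    field_simp
    rw [hNcast]
    ring
  -- (iii) the first upper characteristic, (iv)/(vii) the two lower characteristics as integral
  -- shifts, (vi) the sum of the two upper characteristics
  have hiii : ∀ (p : Fin g → Fin (α + β'')) (k : Fin g → Fin α),
      (α : ℂ)⁻¹ • ((((α + β'' : ℕ) : ℂ)⁻¹ • ((α : ℂ) • (((α + β'' : ℕ) : ℂ) • l₁) +
        (β'' : ℂ) • (0 : Fin g → ℂ) + (α : ℂ) • fun i => ((p i : ℕ) : ℂ))) +
          fun i => ((k i : ℕ) : ℂ)) =
      l₁ + ((α + β'' : ℕ) : ℂ)⁻¹ • (fun i => ((p i : ℕ) : ℂ)) +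
        (α : ℂ)⁻¹ • (fun i => ((k i : ℕ) : ℂ)) := by
    intro p k
    funext i
    simp only [Pi.add_apply, Pi.smul_apply, Pi.zero_apply, smul_eq_mul]
    field_simp
    ring
  have hiv : ∀ A : Fin g → Fin α,
      (α : ℂ) • ((α : ℂ)⁻¹ • l₂ + (((α + β'' : ℕ) : ℂ) * ((α : ℂ))⁻¹) • fun i => ((A i : ℕ) : ℂ)) =
      l₂ + fun i => ((((α + β'') * (A i : ℕ) : ℕ) : ℤ) : ℂ) := by
    intro A
    funext i
    simp only [Pi.add_apply, Pi.smul_apply, smul_eq_mul]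
    push_cast
    field_simp
  have hvii : ∀ A : Fin g → Fin α,
      (α : ℂ) • ((((α + β'' : ℕ) : ℂ) * ((α : ℂ))⁻¹) • fun i => ((A i : ℕ) : ℂ)) -
          (β'' : ℂ) • ((α : ℂ)⁻¹ • l₂) =
      -((β'' : ℂ) • ((α : ℂ)⁻¹ • l₂)) + fun i => ((((α + β'') * (A i : ℕ) : ℕ) : ℤ) : ℂ) := by
    intro A
    funext i
    simp only [Pi.add_apply, Pi.sub_apply, Pi.neg_apply, Pi.smul_apply, smul_eq_mul]
    push_cast
    field_simp
    ring
  have hvi : ∀ (p : Fin g → Fin (α + β'')) (k : Fin g → Fin α),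
      (l₁ + ((α + β'' : ℕ) : ℂ)⁻¹ • (fun i => ((p i : ℕ) : ℂ)) +
          (α : ℂ)⁻¹ • (fun i => ((k i : ℕ) : ℂ))) +
        ((α + β'' : ℕ) : ℂ)⁻¹ • ((0 : Fin g → ℂ) - ((α + β'' : ℕ) : ℂ) • l₁ -
          fun i => ((p i : ℕ) : ℂ)) =
      (α : ℂ)⁻¹ • (fun i => ((k i : ℕ) : ℂ)) := by
    intro p k
    funext i
    simp only [Pi.add_apply, Pi.sub_apply, Pi.smul_apply, Pi.zero_apply, smul_eq_mul]
    field_simp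
    ring
  -- THE EXPANSION (3.a): F_A(s) = Σ_p (Σ_k χ_A(k) M[p,k]) · G_p(s)
  have hF : ∀ (A : Fin g → Fin α) (s : Fin g → ℂ),
      riemannThetaChar (((α + β'' : ℕ) : ℂ) • l₁) ((α : ℂ)⁻¹ • l₂) ((α : ℂ) • Ω)
          ((α : ℂ) • (x₁ - (β'' : ℂ) • s)) *
        riemannThetaChar 0 ((((α + β'' : ℕ) : ℂ) * ((α : ℂ))⁻¹) • fun i => ((A i : ℕ) : ℂ))
          ((β'' : ℂ) • Ω) ((β'' : ℂ) • (x₁ + (α : ℂ) • s)) =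
      ∑ p : Fin g → Fin (α + β''),
        (∑ k : Fin g → Fin α,
          cexp (2 * π * I * (((α : ℂ)⁻¹ • fun i => ((k i : ℕ) : ℂ)) ⬝ᵥ
            fun i => ((((α + β'') * (A i : ℕ) : ℕ) : ℤ) : ℂ))) *
          riemannThetaChar (l₁ + ((α + β'' : ℕ) : ℂ)⁻¹ • (fun i => ((p i : ℕ) : ℂ)) +
            (α : ℂ)⁻¹ • (fun i => ((k i : ℕ) : ℂ))) l₂ Ω₀ x₀) *
        riemannThetaChar (((α + β'' : ℕ) : ℂ)⁻¹ • ((0 : Fin g → ℂ) - ((α + β'' : ℕ) : ℂ) • l₁ -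
            fun i => ((p i : ℕ) : ℂ)))
          (-((β'' : ℂ) • ((α : ℂ)⁻¹ • l₂))) (((α : ℂ) * β'' * ((α + β'' : ℕ) : ℂ)) • Ω)
          (((α : ℂ) * β'') • ((x₁ + (α : ℂ) • s) - (x₁ - (β'' : ℂ) • s))) := by
    intro A s
    rw [riemannThetaChar_mul_riemannThetaChar_level Ω hΩ hcκ hYκ hα hβ'' hα
      (((α + β'' : ℕ) : ℂ) • l₁) ((α : ℂ)⁻¹ • l₂) (0 : Fin g → ℂ)
      ((((α + β'' : ℕ) : ℂ) * ((α : ℂ))⁻¹) • fun i => ((A i : ℕ) : ℂ)) (x₁ - (β'' : ℂ) • s)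
      (x₁ + (α : ℂ) • s)]
    refine Finset.sum_congr rfl fun p _ => ?_
    rw [hmod, harg s, hiv A, hvii A, riemannThetaChar_charShift_snd, Finset.sum_mul,
      Finset.sum_mul]
    refine Finset.sum_congr rfl fun k _ => ?_
    rw [hiii p k, riemannThetaChar_charShift_snd]
    have hchar : (l₁ + ((α + β'' : ℕ) : ℂ)⁻¹ • (fun i => ((p i : ℕ) : ℂ)) +
            (α : ℂ)⁻¹ • (fun i => ((k i : ℕ) : ℂ))) ⬝ᵥ
          (fun i => ((((α + β'') * (A i : ℕ) : ℕ) : ℤ) : ℂ)) +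
        (((α + β'' : ℕ) : ℂ)⁻¹ • ((0 : Fin g → ℂ) - ((α + β'' : ℕ) : ℂ) • l₁ -
            fun i => ((p i : ℕ) : ℂ))) ⬝ᵥ
          (fun i => ((((α + β'') * (A i : ℕ) : ℕ) : ℤ) : ℂ)) =
        ((α : ℂ)⁻¹ • fun i => ((k i : ℕ) : ℂ)) ⬝ᵥ
          fun i => ((((α + β'') * (A i : ℕ) : ℕ) : ℤ) : ℂ) := by
      rw [← add_dotProduct, hvi p k]
    have hphase : cexp (2 * π * I * ((l₁ + ((α + β'' : ℕ) : ℂ)⁻¹ • (fun i => ((p i : ℕ) : ℂ)) +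
            (α : ℂ)⁻¹ • (fun i => ((k i : ℕ) : ℂ))) ⬝ᵥ
          fun i => ((((α + β'') * (A i : ℕ) : ℕ) : ℤ) : ℂ))) *
        cexp (2 * π * I * ((((α + β'' : ℕ) : ℂ)⁻¹ • ((0 : Fin g → ℂ) -
            ((α + β'' : ℕ) : ℂ) • l₁ - fun i => ((p i : ℕ) : ℂ))) ⬝ᵥ
          fun i => ((((α + β'') * (A i : ℕ) : ℕ) : ℤ) : ℂ))) =
        cexp (2 * π * I * (((α : ℂ)⁻¹ • fun i => ((k i : ℕ) : ℂ)) ⬝ᵥ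
          fun i => ((((α + β'') * (A i : ℕ) : ℕ) : ℤ) : ℂ))) := by
      rw [← Complex.exp_add, ← mul_add, hchar]
    rw [← hphase]
    ring
  -- THE EXPANDED FUNCTIONS ARE LINEARLY INDEPENDENT
  have hFind : LinearIndependent ℂ fun (A : Fin g → Fin α) (s : Fin g → ℂ) =>
      riemannThetaChar (((α + β'' : ℕ) : ℂ) • l₁) ((α : ℂ)⁻¹ • l₂) ((α : ℂ) • Ω)
          ((α : ℂ) • (x₁ - (β'' : ℂ) • s)) *
        riemannThetaChar 0 ((((α + β'' : ℕ) : ℂ) * ((α : ℂ))⁻¹) • fun i => ((A i : ℕ) : ℂ))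
          ((β'' : ℂ) • Ω) ((β'' : ℂ) • (x₁ + (α : ℂ) • s)) := by
    -- the `ϑ[0; ((α+β″)/α)A]((β″)Ω, ·)` are linearly independent (distinct second characteristics)
    have hθ : LinearIndependent ℂ fun A : Fin g → Fin α =>
        riemannThetaChar 0 ((((α + β'' : ℕ) : ℂ) * ((α : ℂ))⁻¹) • fun i => ((A i : ℕ) : ℂ))
          ((β'' : ℂ) • Ω) :=
      linearIndependent_riemannThetaChar_snd ((β'' : ℂ) • Ω) (hsymm _) (mul_pos hβr hcκ)
        (smul_im_bound Ω hYκ hβi hβr.le) 0 _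
        (fun A A' h => charShift_injective_of_coprime hα hcop A A' h)
    -- precomposition with the affine bijection `s ↦ β″(x₁ + αs)`
    have hφ : Function.Surjective fun s : Fin g → ℂ => (β'' : ℂ) • (x₁ + (α : ℂ) • s) := by
      intro w
      refine ⟨(α : ℂ)⁻¹ • ((β'' : ℂ)⁻¹ • w - x₁), ?_⟩
      funext i
      simp only [Pi.smul_apply, Pi.add_apply, Pi.sub_apply, smul_eq_mul]
      field_simp
      ring
    have hg := linearIndependent_comp_of_surjective hθ hφ
    -- the fixed factor `f(s) = ϑ[(α+β″)l₁; l₂/α](αΩ, α(x₁ − β″s))` is entire and `≢ 0`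
    have hfd : Differentiable ℂ fun s : Fin g → ℂ =>
        riemannThetaChar (((α + β'' : ℕ) : ℂ) • l₁) ((α : ℂ)⁻¹ • l₂) ((α : ℂ) • Ω)
          ((α : ℂ) • (x₁ - (β'' : ℂ) • s)) := by
      have hd := differentiable_riemannThetaChar ((α : ℂ) • Ω) (hsymm _) (mul_pos hαr hcκ)
        (smul_im_bound Ω hYκ hαi hαr.le) (((α + β'' : ℕ) : ℂ) • l₁) ((α : ℂ)⁻¹ • l₂)
      exact hd.comp (by fun_prop)
    have hf0 : (fun s : Fin g → ℂ =>
        riemannThetaChar (((α + β'' : ℕ) : ℂ) • l₁) ((α : ℂ)⁻¹ • l₂) ((α : ℂ) • Ω)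
          ((α : ℂ) • (x₁ - (β'' : ℂ) • s))) ≠ 0 := by
      obtain ⟨z, hz⟩ := exists_riemannThetaChar_ne_zero ((α : ℂ) • Ω) (hsymm _) (mul_pos hαr hcκ)
        (smul_im_bound Ω hYκ hαi hαr.le) (((α + β'' : ℕ) : ℂ) • l₁) ((α : ℂ)⁻¹ • l₂)
      intro h
      have h1 := congr_fun h ((β'' : ℂ)⁻¹ • (x₁ - (α : ℂ)⁻¹ • z))
      simp only [Pi.zero_apply] at h1
      apply hz
      rw [← h1]
      congr 1
      funext i
      simp only [Pi.smul_apply, Pi.sub_apply, smul_eq_mul]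
      field_simp
      ring
    have hgd : ∀ A : Fin g → Fin α, Differentiable ℂ
        ((fun w : Fin g → ℂ => riemannThetaChar 0
          ((((α + β'' : ℕ) : ℂ) * ((α : ℂ))⁻¹) • fun i => ((A i : ℕ) : ℂ)) ((β'' : ℂ) • Ω) w) ∘
          fun s : Fin g → ℂ => (β'' : ℂ) • (x₁ + (α : ℂ) • s)) := by
      intro A
      have hd := differentiable_riemannThetaChar ((β'' : ℂ) • Ω) (hsymm _) (mul_pos hβr hcκ)
        (smul_im_bound Ω hYκ hβi hβr.le) 0
        ((((α + β'' : ℕ) : ℂ) * ((α : ℂ))⁻¹) • fun i => ((A i : ℕ) : ℂ))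
      exact hd.comp (by fun_prop)
    exact linearIndependent_mul_of_differentiable hg hgd hfd hf0
  -- CONCLUSION: the coefficient vectors are independent and lie in the span of the columns
  have hv := linearIndependent_of_expansion hF hFind
  refine linearIndependent_of_linearIndependent_mem_span hv fun A => ?_
  have hsum : (fun p : Fin g → Fin (α + β'') => ∑ k : Fin g → Fin α,
      cexp (2 * π * I * (((α : ℂ)⁻¹ • fun i => ((k i : ℕ) : ℂ)) ⬝ᵥ
        fun i => ((((α + β'') * (A i : ℕ) : ℕ) : ℤ) : ℂ))) *
      riemannThetaChar (l₁ + ((α + β'' : ℕ) : ℂ)⁻¹ • (fun i => ((p i : ℕ) : ℂ)) +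
        (α : ℂ)⁻¹ • (fun i => ((k i : ℕ) : ℂ))) l₂ Ω₀ x₀) =
      ∑ k : Fin g → Fin α, cexp (2 * π * I * (((α : ℂ)⁻¹ • fun i => ((k i : ℕ) : ℂ)) ⬝ᵥ
        fun i => ((((α + β'') * (A i : ℕ) : ℕ) : ℤ) : ℂ))) •
        fun p : Fin g → Fin (α + β'') =>
          riemannThetaChar (l₁ + ((α + β'' : ℕ) : ℂ)⁻¹ • (fun i => ((p i : ℕ) : ℂ)) +
            (α : ℂ)⁻¹ • (fun i => ((k i : ℕ) : ℂ))) l₂ Ω₀ x₀ := by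
    funext p
    simp only [Finset.sum_apply, Pi.smul_apply, smul_eq_mul]
  rw [hsum]
  exact Submodule.sum_mem _ fun k _ =>
    Submodule.smul_mem _ _ (Submodule.subset_span ⟨k, rfl⟩)

/-- **Theorem 3 in the form "`rank = αⁿ`"**: the columns of
`(ϑ[l₁ + b/β + a/α; l₂](Ω₀, x₀))_{b ∈ {0,…,β−1}^g, a ∈ {0,…,α−1}^g}` span a space of dimension exactly
`α^g` (`gcd(α, β) = 1`, `β > α`). [cite: Koizumi1975GradedAlgebrasTheta, §3 Thm. 3]
[cite: Koizumi1976ThetaRelations, §3] -/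
theorem finrank_span_riemannThetaChar_rank (Ω₀ : Matrix (Fin g) (Fin g) ℂ)
    (hΩ₀ : ∀ i j, Ω₀ i j = Ω₀ j i) {c : ℝ} (hc : 0 < c)
    (hY : ∀ x : Fin g → ℝ, c * ∑ i, x i ^ 2 ≤ ∑ i, ∑ j, x i * (Ω₀ i j).im * x j)
    {α β : ℕ} (hα : 0 < α) (hαβ : α < β) (hcop : Nat.Coprime α β) (l₁ l₂ x₀ : Fin g → ℂ) :
    Module.finrank ℂ (Submodule.span ℂ (Set.range fun (a : Fin g → Fin α) (b : Fin g → Fin β) =>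
      riemannThetaChar (l₁ + ((β : ℂ))⁻¹ • (fun i => ((b i : ℕ) : ℂ)) +
        ((α : ℂ))⁻¹ • (fun i => ((a i : ℕ) : ℂ))) l₂ Ω₀ x₀)) = α ^ g := by
  rw [finrank_span_eq_card (linearIndependent_riemannThetaChar_rank Ω₀ hΩ₀ hc hY hα hαβ hcop l₁ l₂ x₀)]
  simp [Fintype.card_pi]

end Literature.Analysis.SpecialFunctions
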